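import Mathlib
import Summits.ABC.ABC.Statement

/-!
# The two rungs below `ABC` on the exponential wall (solo-ABC-informed, session 1)

Every unconditional bound for abc-triples has the shape `log c ≤ F(rad(abc))` with `F` a *power*
of the radical (Stewart–Yu: `log c ≤ κ · rad^{1/3} (log rad)^3`,
`Literature.NumberTheory.DiophantineGeometry.stewart_yu`, `Literature.Barriers.ABC.BakerMethodBounds`),
whereas `ABC` asks for `log c ≤ (1+ε) log rad + O_ε(1)`.  Two classical statements lie strictly
between and are both OPEN:

* "polynomial abc" (Oesterlé): `∃ M K, ∀ abc-triples, c ≤ K · rad(abc)^M`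
  (J. Oesterlé, *Nouvelles approches du «théorème» de Fermat*, Sém. Bourbaki 694 (1988), §1
  [cite: Oesterle1988, §1]; recorded as open in H. Pasten, *Shimura curves and the abc conjecture*,
  arXiv:1705.09251, §1 and §15.2);
* "subexponential abc": `∀ ε > 0, ∃ K, ∀ abc-triples, log c ≤ K · rad(abc)^ε`
  (the shape (EqSTY) of Pasten, op. cit. §15.2, with every `κ > 0`; open).

This file records only the downward implications `ABC → polynomial abc → subexponential abc`,
with the two rungs written out inline (no new `Prop` constants are introduced under `Summits/`);
neither rung is claimed.  They are the honest intermediate summits: any proof of `ABC` passes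
through both, and no unconditional method reaches either — see the seat's report
`run/shared/lean/ideation/ABC/solo-informed/paper/paper.md` ("the exponential wall"). [folklore]
-/

namespace Summit.ABC.ABC.Theorems

open Literature.NumberTheory.DiophantineGeometry

/-- `ABC` (specialised to `ε = 1`) gives Oesterlé's polynomial abc with exponent `M = 2`. [folklore] -/
theorem soloInformed_polynomialABC_of_abc (h : _root_.ABC) :
    ∃ M : ℕ, ∃ K : ℝ, 0 < K ∧
      ∀ a b c : ℕ, IsABCTriple a b c → (c : ℝ) ≤ K * ((rad a b c : ℕ) : ℝ) ^ M := by
  obtain ⟨C, hC, hC'⟩ := (_root_.ABC_iff.mp h) 1 one_pos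
  refine ⟨2, C, hC, fun a b c habc => ?_⟩
  have hlt := hC' a b c habc
  have hr : ((rad a b c : ℕ) : ℝ) ^ ((1 : ℝ) + 1) = ((rad a b c : ℕ) : ℝ) ^ (2 : ℕ) := by
    rw [show ((1 : ℝ) + 1) = ((2 : ℕ) : ℝ) by norm_num, Real.rpow_natCast]
  rw [hr] at hlt
  exact hlt.le

/-- Polynomial abc gives subexponential abc: for `r ≥ 1`,
`log (K · r^M) ≤ (|log K| + M/ε) · r^ε` by `log r ≤ r^ε/ε`. [folklore] -/
theorem soloInformed_subexpABC_of_polynomialABC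
    (h : ∃ M : ℕ, ∃ K : ℝ, 0 < K ∧
      ∀ a b c : ℕ, IsABCTriple a b c → (c : ℝ) ≤ K * ((rad a b c : ℕ) : ℝ) ^ M) :
    ∀ ε : ℝ, 0 < ε → ∃ K : ℝ, 0 < K ∧
      ∀ a b c : ℕ, IsABCTriple a b c → Real.log (c : ℝ) ≤ K * ((rad a b c : ℕ) : ℝ) ^ ε := by
  obtain ⟨M, K, hK, hK'⟩ := h
  intro ε hε
  refine ⟨|Real.log K| + M / ε + 1, by positivity, fun a b c habc => ?_⟩
  set r : ℝ := ((rad a b c : ℕ) : ℝ) with hr_def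
  have hr1 : 1 ≤ r := by
    have h0 : 0 < rad a b c := Nat.radical_pos _
    rw [hr_def]; exact_mod_cast h0
  have hr0 : 0 < r := by linarith
  have hc0 : (0 : ℝ) < (c : ℝ) := by
    have : 0 < c := by obtain ⟨ha, hb, habc', _⟩ := habc; omega
    exact_mod_cast this
  have hle : (c : ℝ) ≤ K * r ^ M := hK' a b c habc
  have h1 : Real.log (c : ℝ) ≤ Real.log K + (M : ℝ) * Real.log r := by
    have := Real.log_le_log hc0 hle
    rw [Real.log_mul hK.ne' (by positivity), Real.log_pow] at this
    exact this
  have h2 : Real.log r ≤ r ^ ε / ε := Real.log_le_rpow_div hr0.le hε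
  have h3 : (1 : ℝ) ≤ r ^ ε := Real.one_le_rpow hr1 hε.le
  have h4 : Real.log K ≤ |Real.log K| * r ^ ε := by
    calc Real.log K ≤ |Real.log K| := le_abs_self _
      _ = |Real.log K| * 1 := by ring
      _ ≤ |Real.log K| * r ^ ε := by gcongr
  have h5 : (M : ℝ) * Real.log r ≤ (M / ε) * r ^ ε := by
    calc (M : ℝ) * Real.log r ≤ (M : ℝ) * (r ^ ε / ε) := by gcongr
      _ = (M / ε) * r ^ ε := by ring
  have h6 : (0 : ℝ) ≤ r ^ ε := by positivity
  nlinarith [h1, h4, h5, h6]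

/-- The ladder in one line: `ABC → subexponential abc` (through polynomial abc). [folklore] -/
theorem soloInformed_subexpABC_of_abc (h : _root_.ABC) :
    ∀ ε : ℝ, 0 < ε → ∃ K : ℝ, 0 < K ∧
      ∀ a b c : ℕ, IsABCTriple a b c → Real.log (c : ℝ) ≤ K * ((rad a b c : ℕ) : ℝ) ^ ε :=
  soloInformed_subexpABC_of_polynomialABC (soloInformed_polynomialABC_of_abc h)

end Summit.ABC.ABC.Theorems
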